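import Summits.BirchSwinnertonDyer.BirchSwinnertonDyer.Theorems.EisensteinPrimesSurLambdaLocalPairingTower
import Summits.BirchSwinnertonDyer.BirchSwinnertonDyer.Theorems.SchneiderFreeAdditiveX3PoitouTateUnramifiedOrthogonalAllLevels
import Literature.NumberTheory.GaloisRepresentations.PontryaginTateDualInverseLimitScalars
import Literature.NumberTheory.GaloisRepresentations.ContinuousCohomologyCoefficientColimit
import Literature.NumberTheory.GaloisRepresentations.GaloisH1MapBijectiveUnramified
import Literature.NumberTheory.GaloisCohomology.SelmerGroupFiniteProofs
import Literature.Algebra.InverseSystem.DirectedSystemKonig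
import HarnessLib

/-!
# Road «SUR-Λ» (crux 2 `GoodLatticeBDPValue`, by-name input #9 `Greenberg2016.prop263_sur_of_crk`),
# brick C6b: the DUAL SELMER TOWER of a `Λ`-adic module and the Kőnig step — «`lim_m H¹_{𝓕_m^*} = 0`
# ⟹ the finite-level obstruction to lifting vanishes at some level»

Cell `bsd-eis`, width seat `bsd-line-x1-p1-w2` (gen 10); helper for stmt-BirchSwinnertonDyer-19032
(`--supports`), road memo `SUR-LAMBDA-ROAD-w5g9.md` §2 ★(ε), §7.4 C6.  THEOREMS ONLY (no definition, no
named fact, no `sorry`).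

SETTING (Greenberg, Kyoto J. Math. 50 (2010), §2 p. 6, §3.1): a discrete `Γ_K`-module `D` exhausted by
finite stable layers `D_k` with `p^k D_k = 0` (the tree's `DiscreteGaloisModule.TorsionLayers`, C1:
`E.layerRep k`, Tate duals `E.layerDualRep k = Hom(D_k, μ_{p^k})`, inverse system `E.dualSystem` with
transitions `dualRes`, `T* = lim_k Hom(D_k, μ_{p^k})`); a finite set of places `T ⊇ Ω_∞ ∪ {v ∣ p}`
outside which the layers are unramified; and LEVEL LOCAL CONDITIONS `𝓕_k` (Selmer structures on `D_k`,
unramified off `T`, increasing along the inclusions `D_n ⊆ D_m` — in the application the preimages of a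
specification `L v ≤ H¹(K_v, 𝐃)`).  Write `Sel_k := H¹_{𝓕_k^*}(K, Hom(D_k, μ_{p^k}))` for the Selmer group
of the DUAL structure for THE canonical local invariant maps (`LocalInvariants.canonical`).

* §1 `cohomologyMap_dualRes_mem_dualSelmer` — **the dual Selmer groups form a tower**:
  `(dualRes)_* : H¹(K, Hom(D_m, μ_{p^m})) → H¹(K, Hom(D_n, μ_{p^n}))` maps `Sel_m` into `Sel_n` (the
  canonical local pairings of the tower are compatible in `ℚ/ℤ`: C2b
  `zmodToQmodZ_localTatePairingZMod_canonical_map_eq` with `hred = muInclusion_dualRes_apply`, and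
  `zmodToQmodZ` is injective); `finite_dualSelmer` — each `Sel_k` is finite (Milne I 2.6 for the
  canonical family, `unramifiedOrthogonal_of_isPerfect_allLevels`, makes `𝓕_k^*` unramified off `T`;
  `finite_selmerGroup_of_isUnramifiedOutside`).
* §2 **`exists_level_obstruction_eq_zero`** — THE KŐNIG STEP (Greenberg's "`S_{L*}(K,T*) = 0`, so …"):
  given local classes `s_v ∈ H¹(K_v, D_{m₀})` (a finite-level representative of an element of
  `Q_𝓛(K, 𝐃)`), the obstruction functionals `λ_m : Sel_m → ℚ/ℤ`, `y ↦ ∑_{v∈T} ⟨ι_* s_v, loc_v y⟩^{can}_{p^m}/p^m`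
  (`m ≥ m₀`) are compatible along the tower (C2b + `res_map_one`); so if EVERY one-step-compatible
  thread `(y_m ∈ Sel_m)_{m ≥ m₀}` is zero ("`lim_m Sel_m = 0`", which is what `S_{𝓛*}(K, T*) = 0` says
  through `TorsionLayers.continuousCohomologyOneEquiv`), then by Kőnig's lemma for towers of finite
  groups (`Literature.Algebra.InverseSystem.exists_addMonoidHom_eq_zero_of_tower_of_compatible_eq_zero`)
  some `λ_m` vanishes identically: `∑_{v∈T} ⟨ι_* s_v, loc_v y⟩^{can}_{p^m} = 0` for all `y ∈ Sel_m` —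
  exactly the hypothesis `hvanish` of the finite-level lift `SurLambda.exists_phi_eq_of_level` (C6a).

HONEST FRAMING: a helper; closes no stub; no case of Greenberg's Prop. 2.6.3 / 3.2.1, of Poitou–Tate
duality beyond the tree theorems invoked, or of BSD is proved here; no summit statement is proved.
References: [Greenberg2010] §2 p. 6, Prop. 3.1.1 (p. 14), Prop. 3.2.1 (p. 15); [MilneADT2006] I Cor. 2.3,
Thm. 2.6, Thm. 4.10 (b); [NeukirchSchmidtWingberg2008] (1.4.2), (2.7.5); [RibesZalesskii2010] Prop. 1.1.4.
-/

set_option autoImplicit false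
set_option linter.dupNamespace false

noncomputable section

open CategoryTheory Function NumberField IsDedekindDomain Field
open scoped NumberField ContRepresentation

namespace Summit.BirchSwinnertonDyer.BirchSwinnertonDyer.Theorems.SurLambda

open Literature.NumberTheory.GaloisRepresentations Literature.NumberTheory.GaloisCohomology
open Literature.NumberTheory.GaloisRepresentations.DiscreteGaloisModule (mu MuCarrier TateDual tateDual
  localTatePairingZMod unramifiedSubgroup SelmerStructure)
open Literature.NumberTheory.GaloisRepresentations.DiscreteGaloisModule.TorsionLayers
open Literature.AnabelianGeometry.AbsoluteAnabelian.Prop121vii (zmodToQmodZ zmodToQmodZ_injective)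
open Summit.BirchSwinnertonDyer.BirchSwinnertonDyer.Theorems.SchneiderFreeAdditiveX3.PoitouTateReduction
  (exists_muIncl_intertwining unramifiedOrthogonal_of_isPerfect_allLevels)
open _root_.ContinuousCohomology

variable {K : Type} [Field K] [NumberField K] {D : Type} [AddCommGroup D] [TopologicalSpace D]
  [DiscreteTopology D] {τ : DiscreteGaloisModule K D} {p : ℕ} [Fact p.Prime]
  (E : τ.TorsionLayers p) [∀ k, Finite (E.N k)]

/-! ### §0. Local pushes along the layer inclusions -/

omit [Fact p.Prime] [∀ k, Finite (E.N k)] in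
/-- Pushing a local class along `D_n ⊆ D_m ⊆ D_k` is pushing it along `D_n ⊆ D_k`.
[cite: Greenberg2010, §2 p. 6 L1–12] -/
theorem map_layerIncl_map_layerIncl {n m k : ℕ} (h₁ : n ≤ m) (h₂ : m ≤ k) (v : Place K)
    (a : galoisCohomology ((E.layerRep n).toLocal v) 1) :
    galoisCohomology.map ((E.layerInclHom h₂).hom.restrictField (Place.Completion v)) 1
        (galoisCohomology.map ((E.layerInclHom h₁).hom.restrictField (Place.Completion v)) 1 a) =
      galoisCohomology.map ((E.layerInclHom (h₁.trans h₂)).hom.restrictField (Place.Completion v)) 1 a :=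
  ContinuousRep.cohomologyMap_comp_apply_of_eq_one (σ := (E.layerRep n).toLocal v)
    (ρ := (E.layerRep k).toLocal v) (σ' := (E.layerRep m).toLocal v)
    (DiscreteGaloisModule.homOfIntertwining ((E.layerInclHom h₁).hom.restrictField (Place.Completion v)))
    (DiscreteGaloisModule.homOfIntertwining ((E.layerInclHom h₂).hom.restrictField (Place.Completion v)))
    (DiscreteGaloisModule.homOfIntertwining
      ((E.layerInclHom (h₁.trans h₂)).hom.restrictField (Place.Completion v)))
    (fun _ => rfl) a

/-! ### §1. The dual Selmer groups form a tower of finite groups -/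

omit [Fact p.Prime] in
/-- Localisation commutes with the transition map `(dualRes)_*` of the dual tower.
[cite: Greenberg2010, §2 p. 6 L1–12] -/
theorem localization_cohomologyMap_dualRes {n m : ℕ} (h : n ≤ m) (v : Place K)
    (y : galoisCohomology ((E.layerRep m).tateDual (p ^ m)) 1) :
    galoisCohomology.localization ((E.layerRep n).tateDual (p ^ n)) v 1
        (cohomologyMap (E.dualSystem.redHom h) 1 y) =
      galoisCohomology.map ((E.dualSystem.redHom h).hom.restrictField (Place.Completion v)) 1
        (galoisCohomology.localization ((E.layerRep m).tateDual (p ^ m)) v 1 y) :=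
  galoisCohomology.res_map_one (Place.Completion v) (E.dualSystem.redHom h).hom y

/-- **The canonical pairings of the tower in `ℚ/ℤ`, localised**: for `n ≤ m`, a local class `a` at
level `n` and a GLOBAL dual class `y` at level `m`,
`⟨a, loc_v ((dualRes)_* y)⟩^{can}_{p^n} / p^n = ⟨ι_* a, loc_v y⟩^{can}_{p^m} / p^m`.
[cite: Greenberg2010, §3.1 (9)] [cite: NeukirchSchmidtWingberg2008, I §4 Prop. (1.4.2)] -/
theorem zmodToQmodZ_pairing_localization_dualRes {n m : ℕ} (h : n ≤ m) (v : Place K)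
    (a : galoisCohomology ((E.layerRep n).toLocal v) 1)
    (y : galoisCohomology ((E.layerRep m).tateDual (p ^ m)) 1) :
    zmodToQmodZ (p ^ n) (localTatePairingZMod (E.layerRep n) (p ^ n) v (LocalInvariants.canonical K (p ^ n) v)
        a (galoisCohomology.localization ((E.layerRep n).tateDual (p ^ n)) v 1
          (cohomologyMap (E.dualSystem.redHom h) 1 y))) =
      zmodToQmodZ (p ^ m) (localTatePairingZMod (E.layerRep m) (p ^ m) v
        (LocalInvariants.canonical K (p ^ m) v)
        (galoisCohomology.map ((E.layerInclHom h).hom.restrictField (Place.Completion v)) 1 a)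
        (galoisCohomology.localization ((E.layerRep m).tateDual (p ^ m)) v 1 y)) := by
  obtain ⟨j, hj⟩ := exists_muIncl_intertwining (K := K) (pow_dvd_pow p h)
  rw [localization_cohomologyMap_dualRes E h v y]
  exact (zmodToQmodZ_localTatePairingZMod_canonical_map_eq (E.layerRep n) (E.layerRep m)
    (pow_dvd_pow p h) (E.layerInclHom h).hom (E.dualSystem.redHom h).hom
    (fun g x => E.muInclusion_dualRes_apply h g x) j hj v a
    (galoisCohomology.localization ((E.layerRep m).tateDual (p ^ m)) v 1 y)).symm

/-- **The dual Selmer groups form a tower**: if the level conditions increase along the inclusions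
(`ι_* 𝓕_n v ≤ 𝓕_m v` at every place), the map `(dualRes)_* : H¹(K, Hom(D_m, μ_{p^m})) →
H¹(K, Hom(D_n, μ_{p^n}))` sends the dual Selmer group of `𝓕_m` (canonical pairings) into that of `𝓕_n`.
[cite: Greenberg2010, §2 p. 6 and Prop. 3.1.1 (p. 14)] [cite: MilneADT2006, Ch. I, Cor. 2.3] -/
theorem cohomologyMap_dualRes_mem_dualSelmer {n m : ℕ} (h : n ≤ m)
    (𝓕n : SelmerStructure (E.layerRep n)) (𝓕m : SelmerStructure (E.layerRep m))
    (hmono : ∀ (v : Place K), ∀ z ∈ 𝓕n v,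
      galoisCohomology.map ((E.layerInclHom h).hom.restrictField (Place.Completion v)) 1 z ∈ 𝓕m v)
    {y : galoisCohomology ((E.layerRep m).tateDual (p ^ m)) 1}
    (hy : y ∈ ((LocalInvariants.canonical K (p ^ m)).dualSelmerStructure (E.layerRep m) 𝓕m).selmerGroup) :
    cohomologyMap (E.dualSystem.redHom h) 1 y ∈
      ((LocalInvariants.canonical K (p ^ n)).dualSelmerStructure (E.layerRep n) 𝓕n).selmerGroup := by
  refine (SelmerStructure.mem_selmerGroup_iff _ _).2 fun v => ?_
  refine (LocalInvariants.mem_dualLocalCondition_iff _ _ _ _ _).2 fun a ha => ?_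
  apply zmodToQmodZ_injective (p ^ n)
  have hy' : localTatePairingZMod (E.layerRep m) (p ^ m) v (LocalInvariants.canonical K (p ^ m) v)
      (galoisCohomology.map ((E.layerInclHom h).hom.restrictField (Place.Completion v)) 1 a)
      (galoisCohomology.localization ((E.layerRep m).tateDual (p ^ m)) v 1 y) = 0 :=
    (LocalInvariants.mem_dualLocalCondition_iff _ _ _ _ _).1
      ((SelmerStructure.mem_selmerGroup_iff _ _).1 hy v) _ (hmono v a ha)
  have key := zmodToQmodZ_pairing_localization_dualRes E h v a y
  rw [hy', map_zero] at key
  rw [map_zero]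
  exact key

/-- **The dual Selmer groups are finite**: for `T ⊇ Ω_∞ ∪ {v ∣ p}` off which `D_k` and `𝓕_k` are
unramified, `𝓕_k^*` is unramified off `T` (Milne I Thm. 2.6 for THE canonical family) and
`H¹_{𝓕_k^*}(K, Hom(D_k, μ_{p^k}))` is finite. [cite: MilneADT2006, Ch. I, Thm. 2.6 and §6]
[cite: Howard2004HeegnerKolyvagin, Def. 2.1.10 (arXiv:1202.6340 p. 6)] -/
theorem finite_dualSelmer (k : ℕ) (T : Finset (Place K))
    (hT : ∀ v : HeightOneSpectrum (𝓞 K), (Sum.inr v : Place K) ∉ T →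
      ((p ^ k : ℕ) : 𝓞 K) ∉ v.asIdeal ∧ GaloisRep.IsUnramifiedAt v (E.layerRep k))
    (𝓕 : SelmerStructure (E.layerRep k)) (h𝓕 : 𝓕.IsUnramifiedOutside T) :
    Finite ((LocalInvariants.canonical K (p ^ k)).dualSelmerStructure (E.layerRep k) 𝓕).selmerGroup := by
  haveI : Finite (TateDual K (E.N k) (p ^ k)) := E.finite_layerDual k
  have hUO : (LocalInvariants.canonical K (p ^ k)).UnramifiedOrthogonal :=
    unramifiedOrthogonal_of_isPerfect_allLevels _ LocalInvariants.canonical_isPerfect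
  have hdual :
      ((LocalInvariants.canonical K (p ^ k)).dualSelmerStructure (E.layerRep k) 𝓕).IsUnramifiedOutside T :=
    hUO.isUnramifiedOutside_dualSelmerStructure (E.layerRep k) (fun x => E.pow_smul_eq_zero x) hT h𝓕
  exact SelmerStructure.finite_selmerGroup_of_isUnramifiedOutside
    (ρ := (E.layerRep k).tateDual (p ^ k))
    ((LocalInvariants.canonical K (p ^ k)).dualSelmerStructure (E.layerRep k) 𝓕) hdual

/-! ### §2. The Kőnig step -/

/-- **«`lim_m H¹_{𝓕_m^*} = 0` ⟹ the obstruction vanishes at some level» (Greenberg 2010, proof of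
Prop. 3.2.1, the use of `S_{𝓛*}(K, T*) = 0`).**  Let `T ⊇ Ω_∞ ∪ {v ∣ p}` be finite with `D` unramified
off `T`; `𝓕_m` level conditions, unramified off `T` and increasing along the tower; `s_v ∈ H¹(K_v, D_{m₀})`
local classes.  If every one-step-compatible thread `(y_j ∈ H¹_{𝓕_{m₀+j}^*})_{j ≥ 0}` of canonical
dual Selmer classes vanishes, then for some `m ≥ m₀` the level-`m` obstruction
`y ↦ ∑_{v∈T} ⟨ι_* s_v, loc_v y⟩^{can}_{p^m}` is identically `0` on `H¹_{𝓕_m^*}`.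
[cite: Greenberg2010, Prop. 3.2.1 (p. 15) and Prop. 3.1.1 (p. 14)] [cite: RibesZalesskii2010, Prop. 1.1.4]
[cite: MilneADT2006, Ch. I, Thm. 4.10 (b)] -/
theorem exists_level_obstruction_eq_zero (T : Finset (Place K))
    (hTp : ∀ v : HeightOneSpectrum (𝓞 K), ((p : ℕ) : 𝓞 K) ∈ v.asIdeal → (Sum.inr v : Place K) ∈ T)
    (hur : ∀ (k : ℕ) (v : HeightOneSpectrum (𝓞 K)), (Sum.inr v : Place K) ∉ T →
      GaloisRep.IsUnramifiedAt v (E.layerRep k))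
    (𝓕 : ∀ m : ℕ, SelmerStructure (E.layerRep m)) (h𝓕ur : ∀ m, (𝓕 m).IsUnramifiedOutside T)
    (h𝓕mono : ∀ ⦃n m : ℕ⦄ (h : n ≤ m) (v : Place K), ∀ z ∈ 𝓕 n v,
      galoisCohomology.map ((E.layerInclHom h).hom.restrictField (Place.Completion v)) 1 z ∈ 𝓕 m v)
    (m₀ : ℕ) (s : ∀ v : Place K, galoisCohomology ((E.layerRep m₀).toLocal v) 1)
    (hlim : ∀ y : ∀ j : ℕ, galoisCohomology ((E.layerRep (m₀ + j)).tateDual (p ^ (m₀ + j))) 1,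
      (∀ j, y j ∈ ((LocalInvariants.canonical K (p ^ (m₀ + j))).dualSelmerStructure
        (E.layerRep (m₀ + j)) (𝓕 (m₀ + j))).selmerGroup) →
      (∀ j, cohomologyMap (E.dualSystem.redHom (Nat.le_succ (m₀ + j))) 1 (y (j + 1)) = y j) →
      ∀ j, y j = 0) :
    ∃ (m : ℕ) (hm : m₀ ≤ m),
      ∀ y ∈ ((LocalInvariants.canonical K (p ^ m)).dualSelmerStructure (E.layerRep m) (𝓕 m)).selmerGroup,
        ∑ v ∈ T, localTatePairingZMod (E.layerRep m) (p ^ m) v (LocalInvariants.canonical K (p ^ m) v)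
          (galoisCohomology.map ((E.layerInclHom hm).hom.restrictField (Place.Completion v)) 1 (s v))
          (galoisCohomology.localization ((E.layerRep m).tateDual (p ^ m)) v 1 y) = 0 := by
  classical
  haveI hp0 : NeZero p := ⟨(Fact.out : p.Prime).ne_zero⟩
  -- Howard's hypothesis on `T` at every level
  have hT : ∀ (k : ℕ) (v : HeightOneSpectrum (𝓞 K)), (Sum.inr v : Place K) ∉ T →
      ((p ^ k : ℕ) : 𝓞 K) ∉ v.asIdeal ∧ GaloisRep.IsUnramifiedAt v (E.layerRep k) := by
    intro k v hv
    refine ⟨fun h => hv (hTp v (v.isPrime.mem_of_pow_mem k ?_)), hur k v hv⟩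
    rwa [← Nat.cast_pow]
  -- the obstruction at level `m ≥ m₀`, paired with a dual class `y`
  have obsv : ∀ (m : ℕ) (hm : m₀ ≤ m) (v : Place K) (y y' : galoisCohomology ((E.layerRep m).tateDual (p ^ m)) 1),
      localTatePairingZMod (E.layerRep m) (p ^ m) v (LocalInvariants.canonical K (p ^ m) v)
          (galoisCohomology.map ((E.layerInclHom hm).hom.restrictField (Place.Completion v)) 1 (s v))
          (galoisCohomology.localization ((E.layerRep m).tateDual (p ^ m)) v 1 (y + y')) =
        localTatePairingZMod (E.layerRep m) (p ^ m) v (LocalInvariants.canonical K (p ^ m) v)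
            (galoisCohomology.map ((E.layerInclHom hm).hom.restrictField (Place.Completion v)) 1 (s v))
            (galoisCohomology.localization ((E.layerRep m).tateDual (p ^ m)) v 1 y) +
          localTatePairingZMod (E.layerRep m) (p ^ m) v (LocalInvariants.canonical K (p ^ m) v)
            (galoisCohomology.map ((E.layerInclHom hm).hom.restrictField (Place.Completion v)) 1 (s v))
            (galoisCohomology.localization ((E.layerRep m).tateDual (p ^ m)) v 1 y') := by
    intro m hm v y y'
    rw [map_add]
    exact map_add _ _ _
  -- the tower of (finite) dual Selmer groups from level `m₀` on (opaque names, to keep unification cheap)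
  obtain ⟨Sel, hSel⟩ : ∃ Sel : ∀ j : ℕ,
      AddSubgroup (galoisCohomology ((E.layerRep (m₀ + j)).tateDual (p ^ (m₀ + j))) 1),
      ∀ j, Sel j = ((LocalInvariants.canonical K (p ^ (m₀ + j))).dualSelmerStructure
        (E.layerRep (m₀ + j)) (𝓕 (m₀ + j))).selmerGroup := ⟨_, fun _ => rfl⟩
  have hSel_mem : ∀ (j : ℕ) (y : galoisCohomology ((E.layerRep (m₀ + (j + 1))).tateDual (p ^ (m₀ + (j + 1)))) 1),
      y ∈ Sel (j + 1) → cohomologyMap (E.dualSystem.redHom (Nat.le_succ (m₀ + j))) 1 y ∈ Sel j := by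
    intro j y hy
    rw [hSel] at hy ⊢
    exact cohomologyMap_dualRes_mem_dualSelmer E (Nat.le_succ (m₀ + j)) (𝓕 (m₀ + j))
      (𝓕 (m₀ + (j + 1))) (h𝓕mono (Nat.le_succ (m₀ + j))) hy
  haveI hfin : ∀ j, Finite ↥(Sel j) := fun j => by
    rw [hSel]
    exact finite_dualSelmer E (m₀ + j) T (hT (m₀ + j)) (𝓕 (m₀ + j)) (h𝓕ur (m₀ + j))
  obtain ⟨t, t_apply⟩ : ∃ t : ∀ j : ℕ, ↥(Sel (j + 1)) →+ ↥(Sel j), ∀ (j : ℕ) (y : ↥(Sel (j + 1))),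
      ((t j y : ↥(Sel j)) : galoisCohomology ((E.layerRep (m₀ + j)).tateDual (p ^ (m₀ + j))) 1) =
        cohomologyMap (E.dualSystem.redHom (Nat.le_succ (m₀ + j))) 1 y.1 :=
    ⟨fun j => AddMonoidHom.mk'
        (fun y => ⟨cohomologyMap (E.dualSystem.redHom (Nat.le_succ (m₀ + j))) 1 y.1, hSel_mem j y.1 y.2⟩)
        (fun y y' => Subtype.ext (map_add _ _ _)),
      fun _ _ => rfl⟩
  -- the obstruction functionals `λ_m(y) = ∑_{v∈T} ⟨ι_* s_v, loc_v y⟩_{p^m} / p^m`, `m = m₀ + j`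
  obtain ⟨lam, lam_apply⟩ : ∃ lam : ∀ j : ℕ, ↥(Sel j) →+ AddCircle (1 : ℚ), ∀ (j : ℕ) (y : ↥(Sel j)),
      lam j y = zmodToQmodZ (p ^ (m₀ + j)) (∑ v ∈ T,
        localTatePairingZMod (E.layerRep (m₀ + j)) (p ^ (m₀ + j)) v
          (LocalInvariants.canonical K (p ^ (m₀ + j)) v)
          (galoisCohomology.map ((E.layerInclHom (Nat.le_add_right m₀ j)).hom.restrictField
            (Place.Completion v)) 1 (s v))
          (galoisCohomology.localization ((E.layerRep (m₀ + j)).tateDual (p ^ (m₀ + j))) v 1 y.1)) := by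
    refine ⟨fun j => AddMonoidHom.mk' (fun y => zmodToQmodZ (p ^ (m₀ + j)) (∑ v ∈ T,
        localTatePairingZMod (E.layerRep (m₀ + j)) (p ^ (m₀ + j)) v
          (LocalInvariants.canonical K (p ^ (m₀ + j)) v)
          (galoisCohomology.map ((E.layerInclHom (Nat.le_add_right m₀ j)).hom.restrictField
            (Place.Completion v)) 1 (s v))
          (galoisCohomology.localization ((E.layerRep (m₀ + j)).tateDual (p ^ (m₀ + j))) v 1 y.1)))
        (fun y y' => ?_), fun _ _ => rfl⟩
    have hsum : (∑ v ∈ T,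
        localTatePairingZMod (E.layerRep (m₀ + j)) (p ^ (m₀ + j)) v
          (LocalInvariants.canonical K (p ^ (m₀ + j)) v)
          (galoisCohomology.map ((E.layerInclHom (Nat.le_add_right m₀ j)).hom.restrictField
            (Place.Completion v)) 1 (s v))
          (galoisCohomology.localization ((E.layerRep (m₀ + j)).tateDual (p ^ (m₀ + j))) v 1
            (y + y').1)) =
        (∑ v ∈ T,
          localTatePairingZMod (E.layerRep (m₀ + j)) (p ^ (m₀ + j)) v
            (LocalInvariants.canonical K (p ^ (m₀ + j)) v)
            (galoisCohomology.map ((E.layerInclHom (Nat.le_add_right m₀ j)).hom.restrictField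
              (Place.Completion v)) 1 (s v))
            (galoisCohomology.localization ((E.layerRep (m₀ + j)).tateDual (p ^ (m₀ + j))) v 1 y.1)) +
        ∑ v ∈ T,
          localTatePairingZMod (E.layerRep (m₀ + j)) (p ^ (m₀ + j)) v
            (LocalInvariants.canonical K (p ^ (m₀ + j)) v)
            (galoisCohomology.map ((E.layerInclHom (Nat.le_add_right m₀ j)).hom.restrictField
              (Place.Completion v)) 1 (s v))
            (galoisCohomology.localization ((E.layerRep (m₀ + j)).tateDual (p ^ (m₀ + j))) v 1 y'.1) := by
      rw [← Finset.sum_add_distrib]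
      exact Finset.sum_congr rfl fun v _ => obsv (m₀ + j) _ v y.1 y'.1
    exact (congrArg (zmodToQmodZ (p ^ (m₀ + j))) hsum).trans (map_add _ _ _)
  -- compatibility of the functionals along the tower (C2b)
  have hlam : ∀ (j : ℕ) (y : ↥(Sel (j + 1))), lam j (t j y) = lam (j + 1) y := by
    intro j y
    rw [lam_apply, lam_apply, map_sum, map_sum]
    refine Finset.sum_congr rfl fun v _ => ?_
    have h1 := zmodToQmodZ_pairing_localization_dualRes E (Nat.le_succ (m₀ + j)) v
      (galoisCohomology.map ((E.layerInclHom (Nat.le_add_right m₀ j)).hom.restrictField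
        (Place.Completion v)) 1 (s v)) y.1
    have h2 := map_layerIncl_map_layerIncl E (Nat.le_add_right m₀ j) (Nat.le_succ (m₀ + j)) v (s v)
    rw [h2] at h1
    rw [t_apply]
    exact h1
  -- every compatible thread of dual Selmer classes vanishes
  have hlim' : ∀ y : ∀ j : ℕ, ↥(Sel j), (∀ j, t j (y (j + 1)) = y j) → ∀ j, y j = 0 := by
    intro y hy j
    refine Subtype.ext ?_
    refine hlim (fun j => (y j).1) (fun j => by rw [← hSel]; exact (y j).2) (fun j => ?_) j
    rw [← t_apply]
    exact congrArg Subtype.val (hy j)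
  -- Kőnig
  obtain ⟨j₀, hj₀⟩ :=
    Literature.Algebra.InverseSystem.exists_addMonoidHom_eq_zero_of_tower_of_compatible_eq_zero
      t lam hlam hlim'
  refine ⟨m₀ + j₀, Nat.le_add_right m₀ j₀, fun y hy => ?_⟩
  have hy' : y ∈ Sel j₀ := by rw [hSel]; exact hy
  have h0 : lam j₀ ⟨y, hy'⟩ = 0 := by rw [hj₀ j₀ le_rfl]; rfl
  rw [lam_apply] at h0
  exact zmodToQmodZ_injective (p ^ (m₀ + j₀)) (h0.trans (map_zero _).symm)

end Summit.BirchSwinnertonDyer.BirchSwinnertonDyer.Theorems.SurLambda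

end
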